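import Mathlib.Analysis.Calculus.MeanValue
import Mathlib.Analysis.Calculus.Deriv.MeanValue
import Mathlib.Algebra.BigOperators.Intervals
import HarnessLib
import HarnessLib.Audit

/-!
# SoloInformed — the signed crossing number of a piecewise monotone function (Newton–Leibniz elimination, file 2b)

Solo programme `solo-KontsevichZagierPeriods-informed`, session s245 (K-NF, `paper/nl-elimination.md`
§7.2, FILE 2: LEMMA C).

The one-variable heart of the proof that the Newton–Leibniz move of the Kontsevich–Zagier calculus
follows from equidimensional substitutions after flattening: for a function `g` continuous on
`[c₀, c_N]` and strictly increasing, strictly decreasing or constant on each open piece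
`(cᵢ, cᵢ₊₁)` of a chain `c₀ < c₁ < … < c_N`, and a value `y` avoiding the finitely many `g cᵢ`,
the number of increasing pieces on which `g` takes the value `y` minus the number of decreasing
ones equals the **signed interval indicator** `sInd (g c₀) (g c_N) y = 𝟙(g c₀ < y < g c_N) −
𝟙(g c_N < y < g c₀)`.  Geometrically: the sheets `{(x, F(x,t))}` of the graph pieces of a fibrewise
antiderivative `F` cover the region between `F(x, a x)` and `F(x, b x)` with signed multiplicity one
(FILE 4 of the plan turns this into an identity of formal sums of representations).

* `soloInformedStepInd`, `soloInformedSInd` and their algebra (`soloInformed_sInd_add`, telescoping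
  `soloInformed_sum_sInd_eq`, the interpretation `soloInformed_sInd_eq_ite`);
* endpoint comparison and images of open pieces: `soloInformed_le_endpoints_of_strictMonoOn`,
  `soloInformed_mem_image_Ioo_iff_of_strictMonoOn / _of_strictAntiOn`,
  `soloInformed_not_mem_image_Ioo_of_const`;
* the type of a piece from the sign of a derivative: `soloInformed_strictMonoOn_of_hasDerivAt_pos`,
  `soloInformed_strictAntiOn_of_hasDerivAt_neg`, `soloInformed_const_of_hasDerivAt_zero`;
* `soloInformedHit g a b y ∈ {0, 1}` (does `g` hit `y` on `(a, b)`), the piece identity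
  `soloInformed_piece_hit_eq_sInd` and **LEMMA C** `soloInformed_crossing_sum`.

References: M. Kontsevich, D. Zagier, *Periods* (2001), §1.2; this work (THEOREM NF,
`paper/nl-elimination.md` §2, §7.2).
-/

noncomputable section

open scoped BigOperators Topology

namespace Summit.KontsevichZagierPeriods.KontsevichZagierPeriods.Theorems

open Set Filter

/-! ### Signed indicators -/

/-- The step indicator `𝟙(u < y)`, valued in `ℤ`. -/
def soloInformedStepInd (u y : ℝ) : ℤ := if u < y then 1 else 0

/-- The **signed interval indicator** `sInd u v y = 𝟙(u < y) − 𝟙(v < y)`; off `{u, v}` it equals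
`𝟙(u < y < v) − 𝟙(v < y < u)` (`soloInformed_sInd_eq_ite`). -/
def soloInformedSInd (u v y : ℝ) : ℤ := soloInformedStepInd u y - soloInformedStepInd v y

/-- `sInd u u = 0`. -/
@[simp] theorem soloInformed_sInd_self (u y : ℝ) : soloInformedSInd u u y = 0 := sub_self _

/-- **Additivity**: `sInd u v + sInd v w = sInd u w` (everywhere). -/
theorem soloInformed_sInd_add (u v w y : ℝ) :
    soloInformedSInd u v y + soloInformedSInd v w y = soloInformedSInd u w y :=
  sub_add_sub_cancel _ _ _

/-- `sInd v u = − sInd u v`. -/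
theorem soloInformed_sInd_swap (u v y : ℝ) : soloInformedSInd v u y = -soloInformedSInd u v y :=
  (neg_sub _ _).symm

/-- **Telescoping** along a chain: `∑_{i < N} sInd (c i) (c (i+1)) y = sInd (c 0) (c N) y`. -/
theorem soloInformed_sum_sInd_eq (c : ℕ → ℝ) (y : ℝ) (N : ℕ) :
    ∑ i ∈ Finset.range N, soloInformedSInd (c i) (c (i + 1)) y = soloInformedSInd (c 0) (c N) y := by
  induction N with
  | zero => simp
  | succ N ih => rw [Finset.sum_range_succ, ih, soloInformed_sInd_add]

/-- **Interpretation** off the endpoints: for `y ∉ {u, v}`,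
`sInd u v y = 𝟙(u < y < v) − 𝟙(v < y < u)`. -/
theorem soloInformed_sInd_eq_ite {u v y : ℝ} (hu : y ≠ u) (hv : y ≠ v) :
    soloInformedSInd u v y = (if u < y ∧ y < v then 1 else 0) - (if v < y ∧ y < u then 1 else 0) := by
  unfold soloInformedSInd soloInformedStepInd
  rcases lt_or_gt_of_ne hu with hyu | huy <;> rcases lt_or_gt_of_ne hv with hyv | hvy
  · simp only [if_neg (not_lt.2 hyu.le), if_neg (not_lt.2 hyv.le),
      if_neg (fun h : u < y ∧ y < v => absurd h.1 (not_lt.2 hyu.le)),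
      if_neg (fun h : v < y ∧ y < u => absurd h.1 (not_lt.2 hyv.le))]
  · simp only [if_neg (not_lt.2 hyu.le), if_pos hvy,
      if_neg (fun h : u < y ∧ y < v => absurd h.1 (not_lt.2 hyu.le)), if_pos (And.intro hvy hyu)]
  · simp only [if_pos huy, if_neg (not_lt.2 hyv.le), if_pos (And.intro huy hyv),
      if_neg (fun h : v < y ∧ y < u => absurd h.1 (not_lt.2 hyv.le))]
  · simp only [if_pos huy, if_pos hvy, if_neg (fun h : u < y ∧ y < v => absurd h.2 (not_lt.2 hvy.le)),
      if_neg (fun h : v < y ∧ y < u => absurd h.2 (not_lt.2 huy.le))]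
    norm_num

/-- `sInd u v y = 1` off the endpoints iff `u < y < v`. -/
theorem soloInformed_sInd_eq_one_iff {u v y : ℝ} (hu : y ≠ u) (hv : y ≠ v) :
    soloInformedSInd u v y = 1 ↔ u < y ∧ y < v := by
  rw [soloInformed_sInd_eq_ite hu hv]
  by_cases h1 : u < y ∧ y < v
  · rw [if_pos h1, if_neg (fun h => absurd (h1.1.trans h1.2) (lt_asymm (h.1.trans h.2)))]
    simp [h1]
  · rw [if_neg h1]
    by_cases h2 : v < y ∧ y < u
    · rw [if_pos h2]; simp [h1]
    · rw [if_neg h2]; simp [h1]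

/-- `sInd u v y = -1` off the endpoints iff `v < y < u`. -/
theorem soloInformed_sInd_eq_neg_one_iff {u v y : ℝ} (hu : y ≠ u) (hv : y ≠ v) :
    soloInformedSInd u v y = -1 ↔ v < y ∧ y < u := by
  rw [← neg_inj, ← soloInformed_sInd_swap, neg_neg]
  exact soloInformed_sInd_eq_one_iff hv hu

/-! ### Endpoint values and images of open pieces -/

/-- A function continuous on `[a, b]` and strictly increasing on `(a, b)` lies between its endpoint
values there: `g a ≤ g t ≤ g b` for `t ∈ (a, b)` (one-sided limits). [folklore] -/
theorem soloInformed_le_endpoints_of_strictMonoOn {g : ℝ → ℝ} {a b : ℝ} (hab : a < b)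
    (hc : ContinuousOn g (Icc a b)) (hm : StrictMonoOn g (Ioo a b)) {t : ℝ} (ht : t ∈ Ioo a b) :
    g a ≤ g t ∧ g t ≤ g b := by
  constructor
  · have hlim : Tendsto g (𝓝[Ioo a t] a) (𝓝 (g a)) :=
      ((hc a (left_mem_Icc.2 hab.le)).mono fun u hu => ⟨hu.1.le, hu.2.le.trans ht.2.le⟩).tendsto
    haveI : (𝓝[Ioo a t] a).NeBot := left_nhdsWithin_Ioo_neBot ht.1
    refine le_of_tendsto hlim ?_
    filter_upwards [self_mem_nhdsWithin] with u hu
    exact (hm ⟨hu.1, hu.2.trans ht.2⟩ ht hu.2).le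
  · have hlim : Tendsto g (𝓝[Ioo t b] b) (𝓝 (g b)) :=
      ((hc b (right_mem_Icc.2 hab.le)).mono fun u hu => ⟨ht.1.le.trans hu.1.le, hu.2.le⟩).tendsto
    haveI : (𝓝[Ioo t b] b).NeBot := right_nhdsWithin_Ioo_neBot ht.2
    refine ge_of_tendsto hlim ?_
    filter_upwards [self_mem_nhdsWithin] with u hu
    exact (hm ht ⟨ht.1.trans hu.1, hu.2⟩ hu.1).le

/-- **Increasing pieces**: for `g` continuous on `[a, b]`, strictly increasing on `(a, b)`, and
`y ∉ {g a, g b}`: `y ∈ g '' (a, b) ↔ g a < y < g b` (intermediate value theorem). [folklore] -/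
theorem soloInformed_mem_image_Ioo_iff_of_strictMonoOn {g : ℝ → ℝ} {a b y : ℝ} (hab : a < b)
    (hc : ContinuousOn g (Icc a b)) (hm : StrictMonoOn g (Ioo a b)) (hya : y ≠ g a)
    (hyb : y ≠ g b) : y ∈ g '' Ioo a b ↔ g a < y ∧ y < g b := by
  constructor
  · rintro ⟨t, ht, rfl⟩
    have h := soloInformed_le_endpoints_of_strictMonoOn hab hc hm ht
    exact ⟨lt_of_le_of_ne h.1 (Ne.symm hya), lt_of_le_of_ne h.2 hyb⟩
  · intro h
    exact intermediate_value_Ioo hab.le hc h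

/-- **Decreasing pieces**: for `g` continuous on `[a, b]`, strictly decreasing on `(a, b)`, and
`y ∉ {g a, g b}`: `y ∈ g '' (a, b) ↔ g b < y < g a`. [folklore] -/
theorem soloInformed_mem_image_Ioo_iff_of_strictAntiOn {g : ℝ → ℝ} {a b y : ℝ} (hab : a < b)
    (hc : ContinuousOn g (Icc a b)) (hm : StrictAntiOn g (Ioo a b)) (hya : y ≠ g a)
    (hyb : y ≠ g b) : y ∈ g '' Ioo a b ↔ g b < y ∧ y < g a := by
  have h := soloInformed_mem_image_Ioo_iff_of_strictMonoOn (g := fun s => -g s) (y := -y) hab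
    hc.neg hm.neg (by simpa using hya) (by simpa using hyb)
  simp only [neg_lt_neg_iff] at h
  rw [and_comm, ← h]
  constructor
  · rintro ⟨t, ht, rfl⟩; exact ⟨t, ht, rfl⟩
  · rintro ⟨t, ht, hty⟩; exact ⟨t, ht, neg_injective hty⟩

/-- **Constant pieces**: if `g` is continuous on `[a, b]` and constant on `(a, b)` then the
constant is `g a`. [folklore] -/
theorem soloInformed_eq_left_of_const {g : ℝ → ℝ} {a b : ℝ} (hab : a < b)
    (hc : ContinuousOn g (Icc a b)) (hk : ∀ s ∈ Ioo a b, ∀ s' ∈ Ioo a b, g s = g s') {t : ℝ}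
    (ht : t ∈ Ioo a b) : g t = g a := by
  have hlim : Tendsto g (𝓝[Ioo a t] a) (𝓝 (g a)) :=
    ((hc a (left_mem_Icc.2 hab.le)).mono fun u hu => ⟨hu.1.le, hu.2.le.trans ht.2.le⟩).tendsto
  haveI : (𝓝[Ioo a t] a).NeBot := left_nhdsWithin_Ioo_neBot ht.1
  have hconst : Tendsto g (𝓝[Ioo a t] a) (𝓝 (g t)) := by
    refine tendsto_const_nhds.congr' ?_
    filter_upwards [self_mem_nhdsWithin] with u hu
    exact hk t ht u ⟨hu.1, hu.2.trans ht.2⟩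
  exact tendsto_nhds_unique hconst hlim

/-- **Constant pieces are never hit off the endpoint values**: `y ≠ g a ⇒ y ∉ g '' (a, b)`.
[folklore] -/
theorem soloInformed_not_mem_image_Ioo_of_const {g : ℝ → ℝ} {a b y : ℝ} (hab : a < b)
    (hc : ContinuousOn g (Icc a b)) (hk : ∀ s ∈ Ioo a b, ∀ s' ∈ Ioo a b, g s = g s')
    (hya : y ≠ g a) : y ∉ g '' Ioo a b := by
  rintro ⟨t, ht, rfl⟩
  exact hya (soloInformed_eq_left_of_const hab hc hk ht)

/-! ### The type of a piece from the sign of the derivative -/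

/-- Positive derivative on an open interval ⇒ strictly increasing there. [folklore] -/
theorem soloInformed_strictMonoOn_of_hasDerivAt_pos {g f : ℝ → ℝ} {a b : ℝ}
    (hd : ∀ t ∈ Ioo a b, HasDerivAt g (f t) t) (hpos : ∀ t ∈ Ioo a b, 0 < f t) :
    StrictMonoOn g (Ioo a b) := by
  refine strictMonoOn_of_deriv_pos (convex_Ioo a b)
    (fun t ht => (hd t ht).continuousAt.continuousWithinAt) fun t ht => ?_
  rw [interior_Ioo] at ht
  rw [(hd t ht).deriv]
  exact hpos t ht

/-- Negative derivative on an open interval ⇒ strictly decreasing there. [folklore] -/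
theorem soloInformed_strictAntiOn_of_hasDerivAt_neg {g f : ℝ → ℝ} {a b : ℝ}
    (hd : ∀ t ∈ Ioo a b, HasDerivAt g (f t) t) (hneg : ∀ t ∈ Ioo a b, f t < 0) :
    StrictAntiOn g (Ioo a b) := by
  refine strictAntiOn_of_deriv_neg (convex_Ioo a b)
    (fun t ht => (hd t ht).continuousAt.continuousWithinAt) fun t ht => ?_
  rw [interior_Ioo] at ht
  rw [(hd t ht).deriv]
  exact hneg t ht

/-- Zero derivative on an open interval ⇒ constant there (mean value theorem). [folklore] -/
theorem soloInformed_const_of_hasDerivAt_zero {g f : ℝ → ℝ} {a b : ℝ}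
    (hd : ∀ t ∈ Ioo a b, HasDerivAt g (f t) t) (hzero : ∀ t ∈ Ioo a b, f t = 0) :
    ∀ s ∈ Ioo a b, ∀ s' ∈ Ioo a b, g s = g s' := by
  -- `g` has derivative `0` on the open interval, hence is constant on the convex set `Ioo a b`
  have hdiff : DifferentiableOn ℝ g (Ioo a b) := fun t ht =>
    (hd t ht).differentiableAt.differentiableWithinAt
  have hder : ∀ t ∈ Ioo a b, fderivWithin ℝ g (Ioo a b) t = 0 := by
    intro t ht
    rw [fderivWithin_of_isOpen isOpen_Ioo ht, ← toSpanSingleton_deriv, (hd t ht).deriv, hzero t ht]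
    simp
  intro s hs s' hs'
  exact (convex_Ioo a b).is_const_of_fderivWithin_eq_zero hdiff hder hs hs'

/-! ### Hits and the crossing number -/

/-- **Hit indicator**: `1` if `g` takes the value `y` on the open piece `(a, b)`, else `0`. -/
def soloInformedHit (g : ℝ → ℝ) (a b y : ℝ) : ℤ := by
  classical exact if y ∈ g '' Ioo a b then 1 else 0

/-- The hit indicator is `1` on the image. -/
theorem soloInformed_hit_of_mem {g : ℝ → ℝ} {a b y : ℝ} (h : y ∈ g '' Ioo a b) :
    soloInformedHit g a b y = 1 := by
  classical exact if_pos h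

/-- The hit indicator is `0` off the image. -/
theorem soloInformed_hit_of_not_mem {g : ℝ → ℝ} {a b y : ℝ} (h : y ∉ g '' Ioo a b) :
    soloInformedHit g a b y = 0 := by
  classical exact if_neg h

/-- The **type** of `g` on the open piece `(a, b)` with sign `ε ∈ {1, −1, 0}`: strictly increasing,
strictly decreasing, or constant. -/
def SoloInformedPieceType (g : ℝ → ℝ) (a b : ℝ) (ε : ℤ) : Prop :=
  (ε = 1 ∧ StrictMonoOn g (Ioo a b)) ∨ (ε = -1 ∧ StrictAntiOn g (Ioo a b)) ∨
    (ε = 0 ∧ ∀ s ∈ Ioo a b, ∀ s' ∈ Ioo a b, g s = g s')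

/-- The type of a piece from a derivative of constant sign (`ε = 1`: `f > 0`; `ε = −1`: `f < 0`;
`ε = 0`: `f = 0` on the piece). [folklore] -/
theorem soloInformed_pieceType_of_hasDerivAt {g f : ℝ → ℝ} {a b : ℝ} {ε : ℤ}
    (hd : ∀ t ∈ Ioo a b, HasDerivAt g (f t) t)
    (hsign : (ε = 1 ∧ ∀ t ∈ Ioo a b, 0 < f t) ∨ (ε = -1 ∧ ∀ t ∈ Ioo a b, f t < 0) ∨
      (ε = 0 ∧ ∀ t ∈ Ioo a b, f t = 0)) : SoloInformedPieceType g a b ε := by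
  rcases hsign with ⟨hε, h⟩ | ⟨hε, h⟩ | ⟨hε, h⟩
  · exact Or.inl ⟨hε, soloInformed_strictMonoOn_of_hasDerivAt_pos hd h⟩
  · exact Or.inr (Or.inl ⟨hε, soloInformed_strictAntiOn_of_hasDerivAt_neg hd h⟩)
  · exact Or.inr (Or.inr ⟨hε, soloInformed_const_of_hasDerivAt_zero hd h⟩)

/-- **Piece identity**: on one piece of type `ε`, `ε · hit = sInd (g a) (g b)` at every `y` avoiding
the endpoint values. [this work, THEOREM NF, LEMMA C] -/
theorem soloInformed_piece_hit_eq_sInd {g : ℝ → ℝ} {a b y : ℝ} {ε : ℤ} (hab : a < b)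
    (hc : ContinuousOn g (Icc a b)) (hε : SoloInformedPieceType g a b ε) (hya : y ≠ g a)
    (hyb : y ≠ g b) : ε * soloInformedHit g a b y = soloInformedSInd (g a) (g b) y := by
  rcases hε with ⟨rfl, hm⟩ | ⟨rfl, hm⟩ | ⟨rfl, hk⟩
  · -- increasing piece
    rw [one_mul]
    by_cases hy : y ∈ g '' Ioo a b
    · rw [soloInformed_hit_of_mem hy]
      exact ((soloInformed_sInd_eq_one_iff hya hyb).2
        ((soloInformed_mem_image_Ioo_iff_of_strictMonoOn hab hc hm hya hyb).1 hy)).symm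
    · rw [soloInformed_hit_of_not_mem hy, soloInformed_sInd_eq_ite hya hyb,
        if_neg (fun h => hy ((soloInformed_mem_image_Ioo_iff_of_strictMonoOn hab hc hm hya hyb).2 h)),
        if_neg (fun h => ?_)]
      · norm_num
      · -- `g b < y < g a` is impossible on an increasing piece (`g a ≤ g b`)
        have hmid : (a + b) / 2 ∈ Ioo a b := ⟨by linarith, by linarith⟩
        have hle := soloInformed_le_endpoints_of_strictMonoOn hab hc hm hmid
        linarith [hle.1, hle.2, h.1, h.2]
  · -- decreasing piece
    rw [neg_one_mul]
    by_cases hy : y ∈ g '' Ioo a b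
    · rw [soloInformed_hit_of_mem hy]
      exact ((soloInformed_sInd_eq_neg_one_iff hya hyb).2
        ((soloInformed_mem_image_Ioo_iff_of_strictAntiOn hab hc hm hya hyb).1 hy)).symm
    · rw [soloInformed_hit_of_not_mem hy, neg_zero, soloInformed_sInd_eq_ite hya hyb,
        if_neg (fun h => ?_),
        if_neg (fun h => hy ((soloInformed_mem_image_Ioo_iff_of_strictAntiOn hab hc hm hya hyb).2 h))]
      · norm_num
      · -- `g a < y < g b` is impossible on a decreasing piece (`g b ≤ g a`)
        have hmid : (a + b) / 2 ∈ Ioo a b := ⟨by linarith, by linarith⟩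
        have hle := soloInformed_le_endpoints_of_strictMonoOn (g := fun s => -g s) hab hc.neg hm.neg hmid
        simp only [neg_le_neg_iff] at hle
        linarith [hle.1, hle.2, h.1, h.2]
  · -- constant piece: no hit, and `g b = g a`
    rw [zero_mul]
    have hba : g b = g a := by
      -- continuity at `b`: the constant value `g a` is also the right endpoint value
      have hmid : (a + b) / 2 ∈ Ioo a b := ⟨by linarith, by linarith⟩
      have hk' : ∀ s ∈ Ioo a b, ∀ s' ∈ Ioo a b, (fun u => g (-u)) (-s) = (fun u => g (-u)) (-s') := by
        intro s hs s' hs'; simp only [neg_neg]; exact hk s hs s' hs'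
      -- apply the left-endpoint lemma to `u ↦ g (-u)` on `(-b, -a)`
      have hc' : ContinuousOn (fun u => g (-u)) (Icc (-b) (-a)) := by
        refine hc.comp continuousOn_neg fun u hu => ?_
        exact ⟨by linarith [hu.2], by linarith [hu.1]⟩
      have hk'' : ∀ s ∈ Ioo (-b) (-a), ∀ s' ∈ Ioo (-b) (-a), (fun u => g (-u)) s = (fun u => g (-u)) s' :=
        fun s hs s' hs' => hk (-s) ⟨by linarith [hs.2], by linarith [hs.1]⟩ (-s')
          ⟨by linarith [hs'.2], by linarith [hs'.1]⟩
      have h1 := soloInformed_eq_left_of_const (g := fun u => g (-u)) (t := -((a + b) / 2))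
        (by linarith) hc' hk'' ⟨by linarith, by linarith⟩
      have h2 := soloInformed_eq_left_of_const hab hc hk hmid
      simp only [neg_neg] at h1
      rw [← h2, h1]
    rw [hba, soloInformed_sInd_self]

/-- **LEMMA C (signed crossing number).** Let `c 0 < c 1 < … < c N` (`c` strictly increasing on
`{i | i ≤ N}`), let `g` be continuous on
`[c 0, c N]` and of type `ε i ∈ {1, −1, 0}` (strictly increasing / strictly decreasing / constant)
on each open piece `(c i, c (i+1))`, and let `y` avoid the values `g (c i)`, `i ≤ N`.  Then
`∑_{i < N} ε i · hit_i(y) = sInd (g (c 0)) (g (c N)) y`: the number of increasing pieces hitting `y`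
minus the number of decreasing ones is `𝟙(g(c 0) < y < g(c N)) − 𝟙(g(c N) < y < g(c 0))`.
[this work, THEOREM NF, LEMMA C] -/
theorem soloInformed_crossing_sum {g : ℝ → ℝ} {c : ℕ → ℝ} {N : ℕ} {ε : ℕ → ℤ}
    (hc : StrictMonoOn c {i | i ≤ N}) (hg : ContinuousOn g (Icc (c 0) (c N)))
    (hε : ∀ i < N, SoloInformedPieceType g (c i) (c (i + 1)) (ε i)) {y : ℝ}
    (hy : ∀ i ≤ N, y ≠ g (c i)) :
    ∑ i ∈ Finset.range N, ε i * soloInformedHit g (c i) (c (i + 1)) y =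
      soloInformedSInd (g (c 0)) (g (c N)) y := by
  rw [← soloInformed_sum_sInd_eq (fun i => g (c i)) y N]
  refine Finset.sum_congr rfl fun i hi => ?_
  rw [Finset.mem_range] at hi
  have hN : N ∈ {i | i ≤ N} := le_refl N
  have h0 : 0 ∈ {i | i ≤ N} := Nat.zero_le N
  have hi' : i ∈ {i | i ≤ N} := hi.le
  have hi1 : i + 1 ∈ {i | i ≤ N} := Nat.succ_le_of_lt hi
  have h0i : c 0 ≤ c i := hc.monotoneOn h0 hi' (Nat.zero_le i)
  have hiN : c (i + 1) ≤ c N := hc.monotoneOn hi1 hN (Nat.succ_le_of_lt hi)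
  have hii : c i < c (i + 1) := hc hi' hi1 (Nat.lt_succ_self i)
  exact soloInformed_piece_hit_eq_sInd hii (hg.mono (Icc_subset_Icc h0i hiN)) (hε i hi) (hy i hi.le)
    (hy (i + 1) hi)

/-- **LEMMA C, indicator form.** Under the hypotheses of `soloInformed_crossing_sum`, for `y`
avoiding the `g (c i)`: the signed count is `1` if `g (c 0) < y < g (c N)`, `−1` if
`g (c N) < y < g (c 0)`, and `0` otherwise. [this work, THEOREM NF, LEMMA C] -/
theorem soloInformed_crossing_sum_eq_ite {g : ℝ → ℝ} {c : ℕ → ℝ} {N : ℕ} {ε : ℕ → ℤ}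
    (hc : StrictMonoOn c {i | i ≤ N}) (hg : ContinuousOn g (Icc (c 0) (c N)))
    (hε : ∀ i < N, SoloInformedPieceType g (c i) (c (i + 1)) (ε i)) {y : ℝ}
    (hy : ∀ i ≤ N, y ≠ g (c i)) :
    ∑ i ∈ Finset.range N, ε i * soloInformedHit g (c i) (c (i + 1)) y =
      (if g (c 0) < y ∧ y < g (c N) then 1 else 0) - (if g (c N) < y ∧ y < g (c 0) then 1 else 0) := by
  rw [soloInformed_crossing_sum hc hg hε hy,
    soloInformed_sInd_eq_ite (hy 0 (Nat.zero_le N)) (hy N le_rfl)]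

end Summit.KontsevichZagierPeriods.KontsevichZagierPeriods.Theorems
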